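import Summits.AnomalousDissipation.AnomalousDissipation.Theorems.RelaxingFamily.Negative.LinearEnstrophyBudget
import Literature.Analysis.FluidPDE.LerayHopfUniformEnergyMomentum
import Literature.Analysis.FluidPDE.LerayHopfTranslate
import Literature.Analysis.FluidPDE.AlexakisDoeringInterpolation
import Summits.AnomalousDissipation.AnomalousDissipation.Theorems.TwodBoundedEnergyZeroMomentum.Negative.ShellPincer
import Literature.Analysis.FluidPDE.LerayHopfRestartTorus
import HarnessLib

/-!
# Negative knowledge for the crux `RelaxingFamily` (stmt-AnomalousDissipation-15009), III: single-shell
# forcing is excluded (`RelaxingFamily_false_without_multiShell`)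

Refuted strengthening (`_false_without_` shape, cdisprove seat) of
`Summit.AnomalousDissipation.AnomalousDissipation.Theses.LimitingAbsorption.RelaxingFamily` (route
`route-AnomalousDissipation-LimitingAbsorption`, crux r3; supports stmt-AnomalousDissipation-15009) — the
route's own "natural first theorem" (kill criteria: single-shell `g` is dead by ShellPincer + Seis):

* `relaxingFamily_false_without_multiShell : ¬ RelaxingFamilyUnder SingleShell` — UNCONDITIONAL: no
  witness of the crux is driven by a force supported on ONE Fourier shell `|k|² = m` (any Kolmogorov /
  monochromatic forcing, any shell, any data). Any proof of `RelaxingFamily` must use a force spanning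
  at least two shells.

Chain (per level `j`, constants uniform in `j`): restart the trajectory at a good time `s₀`
(`Torus.IsGlobalLerayHopf.exists_isGlobalLerayHopf_translate`: Leray–Hopf from the `L²` datum `v(s₀)`,
so no hypothesis on the crux's data `v₀ j` is needed); the every-solution pincer
`‖∇v(t)‖₂² ≤ 4π²m‖v(t)‖₂² + K e^{-8π²mν(t-1)}` (`toReal_eGradNormSq_le_of_singleShell`, Tran–Shepherd 2002
/ CTV 2013, in tree) integrated against the honest Cesàro energy bound `∫₀ᵀ‖v‖₂² ≤ (E+1)T`
(`meanEnergy ≤ E`, bounded running means: FMRT 2001 (3.2)) gives `∫₀ᵀ ‖∇v‖₂² ≤ (8π²m(E+1)+1)·T` for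
large `T`; the ARG-MAX PHASE lemma (`exists_phase_linear_budget`: maximise `∫₀^τ f - (A+1)τ`) turns a
Cesàro bound into a phase with a linear windowed budget for ALL window lengths; with the energy clause
(automatic for mean-zero forces, FMRT 2001 (3.2)) this is the class `QuadraticEnstrophyBudget`, excluded
by the Seis floor (`Negative/LinearEnstrophyBudget.lean`).

## References

* P. Constantin, A. Tarfulea, V. Vicol, ARMA 212 (2014) = arXiv:1304.0929, §2 (enst); C. V. Tran,
  T. G. Shepherd, Physica D 165 (2002) §4 (single-shell enstrophy constraint). [`ConstantinTarfuleaVicol2013`]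
* C. Foias, O. Manley, R. Rosa, R. Temam, *Navier–Stokes Equations and Turbulence*, CUP 2001,
  Ch. IV §3.1 (3.2). [`FMRT2001`]
* C. Seis, Comm. Math. Phys. 399 (2023) = arXiv:2003.08794, Thm. 2, Rmk. 1. [`Seis2022`]
-/

noncomputable section

open MeasureTheory Set Filter Function TopologicalSpace Topology intervalIntegral UnitAddTorus
open scoped ENNReal NNReal InnerProductSpace

namespace Summit.AnomalousDissipation.AnomalousDissipation.Theorems.RelaxingFamily.Negative

-- D-0017: single-problem summit ⇒ `Summit.AnomalousDissipation.AnomalousDissipation.…` by design.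
set_option linter.dupNamespace false

open Literature.Analysis.FunctionSpaces Literature.Analysis.FunctionSpaces.Torus
open Literature.Analysis.FluidPDE Literature.Analysis.FluidPDE.Torus
open Summit.AnomalousDissipation.AnomalousDissipation.Theses.LimitingAbsorption
open Summit.AnomalousDissipation.AnomalousDissipation.Theorems.TwodBoundedEnergyZeroMomentum.Negative

/-- The unit flat 2-torus (local notation). -/
local notation "𝕋²" => UnitAddTorus (Fin 2)
/-- Planar vectors (local notation). -/
local notation "E²" => EuclideanSpace ℝ (Fin 2)

/-! ## Real-variable lemmas: from Cesàro bounds to a phase with a linear windowed budget -/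

/-- **Arg-max phase.** If `f ≥ 0` is locally integrable on `(0, ∞)` and `∫₀ᵀ f ≤ A T` for all
`T ≥ T₀` (`T₀ > 0`, `A ≥ 0`), then some phase `s ∈ [0, T₀)` has the LINEAR windowed budget
`∫ₛ^{s+t} f ≤ (2A + 1) t` for every `t > 0` — take `s` maximising `τ ↦ ∫₀^τ f - (A + 1) τ` on
`[0, 2T₀]`: inside the window the penalised primitive does not increase, beyond it the Cesàro bound
from `0` applies with `s < T₀ < t`. [folklore] -/
theorem exists_phase_linear_budget {f : ℝ → ℝ} (hf0 : ∀ t, 0 ≤ f t)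
    (hfi : ∀ T, 0 < T → IntegrableOn f (Ioc 0 T)) {A T₀ : ℝ} (hA : 0 ≤ A) (hT₀ : 0 < T₀)
    (hces : ∀ T, T₀ ≤ T → ∫ t in (0 : ℝ)..T, f t ≤ A * T) :
    ∃ s, 0 ≤ s ∧ s < T₀ ∧ ∀ t, 0 < t → ∫ τ in s..(s + t), f τ ≤ (2 * A + 1) * t := by
  set L : ℝ := 2 * T₀ with hL
  have hL0 : 0 < L := by positivity
  have hii : ∀ a b : ℝ, 0 ≤ a → a ≤ b → IntervalIntegrable f volume a b := by
    intro a b ha hab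
    rcases eq_or_lt_of_le hab with h | h
    · subst h; exact IntervalIntegrable.refl
    · rw [intervalIntegrable_iff_integrableOn_Ioc_of_le hab]
      exact (hfi b (ha.trans_lt h)).mono_set (Ioc_subset_Ioc_left ha)
  set P : ℝ → ℝ := fun τ => ∫ t in (0 : ℝ)..τ, f t with hP
  set B : ℝ := A + 1 with hB
  set F : ℝ → ℝ := fun τ => P τ - B * τ with hF
  have hPcont : ContinuousOn P (Icc 0 L) := by
    have hint : IntegrableOn f (Icc 0 L) :=
      (integrableOn_Icc_iff_integrableOn_Ioc (μ := volume)).2 (hfi L hL0)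
    have h := intervalIntegral.continuousOn_primitive (μ := volume) (a := 0) (b := L) hint
    refine h.congr fun τ hτ => ?_
    simp only [hP]
    rw [intervalIntegral.integral_of_le hτ.1]
  have hFcont : ContinuousOn F (Icc 0 L) := hPcont.sub (by fun_prop)
  obtain ⟨s, hs, hmax⟩ := isCompact_Icc.exists_isMaxOn (nonempty_Icc.2 hL0.le) hFcont
  have hF0 : F 0 = 0 := by simp [hF, hP]
  have hFs : 0 ≤ F s := by
    have := (isMaxOn_iff.1 hmax) 0 (left_mem_Icc.2 hL0.le)
    rwa [hF0] at this
  have hsT₀ : s < T₀ := by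
    by_contra h
    have h : T₀ ≤ s := not_lt.1 h
    have h1 : P s ≤ A * s := hces s h
    have h2 : F s ≤ A * s - B * s := by simp only [hF]; linarith
    have h3 : A * s - B * s = -s := by rw [hB]; ring
    have : 0 < s := hT₀.trans_le h
    linarith
  refine ⟨s, hs.1, hsT₀, fun t ht => ?_⟩
  have hst : s ≤ s + t := by linarith
  have hsplit : ∫ τ in s..(s + t), f τ = P (s + t) - P s := by
    simp only [hP]
    rw [eq_sub_iff_add_eq, add_comm,
      intervalIntegral.integral_add_adjacent_intervals (hii 0 s le_rfl hs.1) (hii s (s + t) hs.1 hst)]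
  rcases le_or_gt (s + t) L with hcase | hcase
  · have hle : F (s + t) ≤ F s := (isMaxOn_iff.1 hmax) (s + t) ⟨by linarith [hs.1], hcase⟩
    simp only [hF] at hle
    rw [hsplit]
    have hBt : B * t ≤ (2 * A + 1) * t := by rw [hB]; nlinarith
    linarith
  · have hmono : ∫ τ in s..(s + t), f τ ≤ ∫ τ in (0 : ℝ)..(s + t), f τ :=
      intervalIntegral.integral_mono_interval hs.1 hst le_rfl
        (Eventually.of_forall fun τ => hf0 τ) (hii 0 (s + t) le_rfl (hs.1.trans hst))
    have hT : T₀ ≤ s + t := by rw [hL] at hcase; linarith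
    have hts : s < t := by rw [hL] at hcase; linarith
    calc ∫ τ in s..(s + t), f τ ≤ A * (s + t) := hmono.trans (hces (s + t) hT)
      _ ≤ A * (t + t) := by gcongr
      _ ≤ (2 * A + 1) * t := by nlinarith

/-- `∫₁ᵀ e^{-ct} dt ≤ 1/c` for `c > 0`. [folklore] -/
theorem integral_exp_neg_mul_le {c : ℝ} (hc : 0 < c) (T : ℝ) :
    ∫ t in (1 : ℝ)..T, Real.exp (-c * t) ≤ 1 / c := by
  have hderiv : ∀ t ∈ uIcc (1 : ℝ) T,
      HasDerivAt (fun t => -(Real.exp (-c * t)) / c) (Real.exp (-c * t)) t := by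
    intro t _
    have h1 : HasDerivAt (fun t => -c * t) (-c) t := by
      simpa using (hasDerivAt_id t).const_mul (-c)
    have h2 : HasDerivAt (fun t => -(Real.exp (-c * t)) / c) (-(Real.exp (-c * t) * -c) / c) t :=
      (h1.exp).neg.div_const c
    refine h2.congr_deriv ?_
    rw [mul_neg, neg_neg, mul_div_assoc, div_self hc.ne', mul_one]
  rw [intervalIntegral.integral_eq_sub_of_hasDerivAt hderiv ((by fun_prop : Continuous fun t =>
    Real.exp (-c * t)).intervalIntegrable _ _)]
  have h1 : 0 < Real.exp (-c * T) := Real.exp_pos _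
  have h2 : Real.exp (-c * 1) ≤ 1 := Real.exp_le_one_iff.2 (by nlinarith)
  rw [div_sub_div_same, div_le_div_iff_of_pos_right hc]
  linarith

/-- **Cesàro enstrophy from the pincer.** Let `Z, W ≥ 0` be locally integrable on `(0,∞)` with the
pointwise pincer `Z t ≤ Λ W t + C e^{-ct}` for `t ≥ 1` (`Λ, C ≥ 0`, `c > 0`) and the Cesàro bound
`∫₀ᵀ W ≤ B T` for `T ≥ T₁`. Then `∫₀ᵀ Z ≤ (Λ B + 1) T` for all large `T`: the transient integrates
to `≤ C/c` and the first unit of time to a constant. [folklore] -/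
theorem exists_cesaro_of_pincer {Z W : ℝ → ℝ} (hZ0 : ∀ t, 0 ≤ Z t) (hW0 : ∀ t, 0 ≤ W t)
    (hZi : ∀ T, 0 < T → IntegrableOn Z (Ioc 0 T)) (hWi : ∀ T, 0 < T → IntegrableOn W (Ioc 0 T))
    {Λ C c B T₁ : ℝ} (hΛ : 0 ≤ Λ) (hC : 0 ≤ C) (hc : 0 < c)
    (hpin : ∀ t, 1 ≤ t → Z t ≤ Λ * W t + C * Real.exp (-c * t))
    (hces : ∀ T, T₁ ≤ T → ∫ t in (0 : ℝ)..T, W t ≤ B * T) :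
    ∃ T₀, 0 < T₀ ∧ ∀ T, T₀ ≤ T → ∫ t in (0 : ℝ)..T, Z t ≤ (Λ * B + 1) * T := by
  have hii : ∀ (f : ℝ → ℝ), (∀ T, 0 < T → IntegrableOn f (Ioc 0 T)) →
      ∀ a b : ℝ, 0 ≤ a → a ≤ b → IntervalIntegrable f volume a b := by
    intro f hfi a b ha hab
    rcases eq_or_lt_of_le hab with h | h
    · subst h; exact IntervalIntegrable.refl
    · rw [intervalIntegrable_iff_integrableOn_Ioc_of_le hab]
      exact (hfi b (ha.trans_lt h)).mono_set (Ioc_subset_Ioc_left ha)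
  set D : ℝ := ∫ t in (0 : ℝ)..1, Z t with hD
  have hD0 : 0 ≤ D := intervalIntegral.integral_nonneg zero_le_one fun t _ => hZ0 t
  set T₀ : ℝ := max (max 1 T₁) (D + C / c) with hT₀
  have hT₀1 : 1 ≤ T₀ := (le_max_left _ _).trans (le_max_left _ _)
  refine ⟨T₀, one_pos.trans_le hT₀1, fun T hT => ?_⟩
  have hT1 : 1 ≤ T := hT₀1.trans hT
  have hTT₁ : T₁ ≤ T := ((le_max_right _ _).trans (le_max_left _ _)).trans hT
  have hTD : D + C / c ≤ T := (le_max_right _ _).trans hT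
  have hT0 : 0 < T := one_pos.trans_le hT1
  have hsplit : ∫ t in (0 : ℝ)..T, Z t = D + ∫ t in (1 : ℝ)..T, Z t := by
    rw [hD, intervalIntegral.integral_add_adjacent_intervals (hii Z hZi 0 1 le_rfl zero_le_one)
      (hii Z hZi 1 T zero_le_one hT1)]
  have hexpi : IntervalIntegrable (fun t => C * Real.exp (-c * t)) volume 1 T :=
    ((by fun_prop : Continuous fun t => C * Real.exp (-c * t)).intervalIntegrable _ _)
  have hWi1 : IntervalIntegrable W volume 1 T := hii W hWi 1 T zero_le_one hT1
  have h1 : ∫ t in (1 : ℝ)..T, Z t ≤ ∫ t in (1 : ℝ)..T, (Λ * W t + C * Real.exp (-c * t)) :=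
    intervalIntegral.integral_mono_on hT1 (hii Z hZi 1 T zero_le_one hT1)
      ((hWi1.const_mul Λ).add hexpi) fun t ht => hpin t ht.1
  have h2 : ∫ t in (1 : ℝ)..T, (Λ * W t + C * Real.exp (-c * t)) =
      Λ * (∫ t in (1 : ℝ)..T, W t) + C * ∫ t in (1 : ℝ)..T, Real.exp (-c * t) := by
    rw [intervalIntegral.integral_add (hWi1.const_mul Λ) hexpi, intervalIntegral.integral_const_mul,
      intervalIntegral.integral_const_mul]
  have h3 : ∫ t in (1 : ℝ)..T, W t ≤ B * T := by
    have hmono : ∫ t in (1 : ℝ)..T, W t ≤ ∫ t in (0 : ℝ)..T, W t :=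
      intervalIntegral.integral_mono_interval zero_le_one hT1 le_rfl
        (Eventually.of_forall fun t => hW0 t) (hii W hWi 0 T le_rfl hT0.le)
    exact hmono.trans (hces T hTT₁)
  have h4 : ∫ t in (1 : ℝ)..T, Real.exp (-c * t) ≤ 1 / c := integral_exp_neg_mul_le hc T
  have h5 : C * ∫ t in (1 : ℝ)..T, Real.exp (-c * t) ≤ C / c := by
    calc C * ∫ t in (1 : ℝ)..T, Real.exp (-c * t) ≤ C * (1 / c) := mul_le_mul_of_nonneg_left h4 hC
      _ = C / c := by ring
  rw [hsplit]
  calc D + ∫ t in (1 : ℝ)..T, Z t ≤ D + (Λ * (B * T) + C / c) := by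
        refine add_le_add le_rfl (h1.trans ?_)
        rw [h2]
        exact add_le_add (mul_le_mul_of_nonneg_left h3 hΛ) h5
    _ ≤ (Λ * B + 1) * T := by nlinarith

/-- **Cesàro bounds survive a time shift** (nonnegative observable): if `∫₀ᵀ W ≤ B T` for
`T ≥ T₁ > 0` (`B ≥ 0`) and `s₀ ≥ 0`, then `∫₀ᵀ W(· + s₀) ≤ 2B T` for `T ≥ max T₁ s₀`. [folklore] -/
theorem cesaro_translate {W : ℝ → ℝ} (hW0 : ∀ t, 0 ≤ W t)
    (hWi : ∀ T, 0 < T → IntegrableOn W (Ioc 0 T)) {B T₁ s₀ : ℝ} (hB : 0 ≤ B) (hs₀ : 0 ≤ s₀)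
    (hT₁ : 0 < T₁) (hces : ∀ T, T₁ ≤ T → ∫ t in (0 : ℝ)..T, W t ≤ B * T) :
    ∀ T, max T₁ s₀ ≤ T → ∫ t in (0 : ℝ)..T, W (t + s₀) ≤ 2 * B * T := by
  intro T hT
  have hT1 : T₁ ≤ T := (le_max_left _ _).trans hT
  have hTs : s₀ ≤ T := (le_max_right _ _).trans hT
  have hT0 : 0 < T := hT₁.trans_le hT1
  have hi : IntervalIntegrable W volume 0 (T + s₀) := by
    rw [intervalIntegrable_iff_integrableOn_Ioc_of_le (by linarith)]
    exact hWi (T + s₀) (by linarith)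
  rw [intervalIntegral.integral_comp_add_right W s₀, zero_add]
  calc ∫ t in s₀..(T + s₀), W t ≤ ∫ t in (0 : ℝ)..(T + s₀), W t :=
        intervalIntegral.integral_mono_interval hs₀ (by linarith) le_rfl
          (Eventually.of_forall fun t => hW0 t) hi
    _ ≤ B * (T + s₀) := hces _ (by linarith)
    _ ≤ 2 * B * T := by nlinarith

/-! ## Leray–Hopf inputs -/

section LerayHopf

variable {ν : ℝ} {g : 𝕋² → E²} {v₀ : 𝕋² → E²} {v : ℝ → 𝕋² → E²}

/-- **Cesàro energy from the mean energy** (honest `limsup`: the running means of the energy of a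
planar Leray–Hopf solution with mean-zero steady force are bounded, FMRT 2001 (3.2)):
`meanEnergy v ≤ E` gives `∫₀ᵀ ‖v‖₂² ≤ (E + 1) T` for all large `T`. [cite: FMRT2001, Ch. IV §3.1 (3.2)] -/
theorem exists_cesaro_energy_le (hν : 0 < ν) (hg : IsSmooth g) (hgm : HasZeroMean g)
    (hv : IsGlobalLerayHopf ν (fun _ => g) v₀ v) {E : ℝ} (hE : meanEnergy v ≤ E) :
    ∃ T₁, 0 < T₁ ∧ ∀ T, T₁ ≤ T → ∫ t in (0 : ℝ)..T, (∫ x, ‖v t x‖ ^ 2) ≤ (E + 1) * T := by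
  have hb := hv.isBoundedUnder_timeMean_energy hν (hg.memLp 2) hgm
  have hlim : limsup (timeMean fun t => ∫ x, ‖v t x‖ ^ 2) atTop < E + 1 := by
    have : meanEnergy v = limsup (timeMean fun t => ∫ x, ‖v t x‖ ^ 2) atTop := rfl
    rw [← this]; linarith
  have hev := Filter.eventually_lt_of_limsup_lt hlim hb
  obtain ⟨T₁, hT₁⟩ := eventually_atTop.1 (hev.and (eventually_gt_atTop 0))
  refine ⟨max T₁ 1, lt_max_of_lt_right one_pos, fun T hT => ?_⟩
  obtain ⟨h1, h2⟩ := hT₁ T ((le_max_left _ _).trans hT)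
  unfold timeMean at h1
  rw [inv_mul_lt_iff₀ h2] at h1
  linarith

/-- **Single-shell forcing: a phase with a quadratic windowed enstrophy budget, slope uniform in the
level.** For `ν > 0`, a smooth mean-zero force `g` supported on ONE Fourier shell `|k|² = m`
(`m > 0`) and any global Leray–Hopf solution `v` (any datum) with `meanEnergy v ≤ E` (`E ≥ 0`),
there is a phase `s ≥ 0` with `∫₀ᵗ ‖∇v(s + τ)‖₂² dτ ≤ (16π²m(E+1) + 3)(1 + t)` for every `t > 0`.
Restart `v` at a good time `s₀` (`exists_isGlobalLerayHopf_translate`, `L²` datum `v(s₀)`), apply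
the every-solution pincer `‖∇v‖₂² ≤ 4π²m‖v‖₂² + K e^{-8π²mν(t-1)}` (ShellPincer; Tran–Shepherd 2002,
CTV 2013), integrate it against the Cesàro energy bound, and pick the arg-max phase. [cite: ConstantinTarfuleaVicol2013, §2 (enst)] -/
theorem exists_phase_quadraticBudget_of_singleShell (hν : 0 < ν) (hg : IsSmooth g)
    (hgm : HasZeroMean g) {m : ℝ} (hm : 0 < m)
    (hg1 : ∀ k : Fin 2 → ℤ, freqNormSq k ≠ m → mFourierCoeff (EuclideanSpace.complexify ∘ g) k = 0)
    (hv : IsGlobalLerayHopf ν (fun _ => g) v₀ v) {E : ℝ} (hE0 : 0 ≤ E) (hE : meanEnergy v ≤ E) :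
    ∃ s : ℝ, 0 ≤ s ∧ ∀ t : ℝ, 0 < t →
      ∫⁻ τ in Ioo 0 t, eGradNormSq (v (s + τ)) ≤
        ENNReal.ofReal ((16 * Real.pi ^ 2 * m * (E + 1) + 3) * (1 + t)) := by
  -- restart at a good time `s₀ > 0`
  obtain ⟨s₀, hs₀, -, hw⟩ := hv.exists_isGlobalLerayHopf_translate hg hν.le
  -- the pincer for the restarted solution
  obtain ⟨K, hK0, hK⟩ :=
    toReal_eGradNormSq_le_of_singleShell hν hg hm hg1 (hv.memLp_two hs₀.le) hw
  set Λ : ℝ := 4 * Real.pi ^ 2 * m with hΛ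
  set cc : ℝ := 8 * Real.pi ^ 2 * m * ν with hcc
  have hΛ0 : 0 ≤ Λ := by positivity
  have hcc0 : 0 < cc := by positivity
  set Z : ℝ → ℝ := fun t => (eGradNormSq (v (t + s₀))).toReal with hZ
  set W : ℝ → ℝ := fun t => ∫ x, ‖v (t + s₀) x‖ ^ 2 with hW
  have hZ0 : ∀ t, 0 ≤ Z t := fun t => ENNReal.toReal_nonneg
  have hW0 : ∀ t, 0 ≤ W t := fun t => integral_nonneg fun _ => sq_nonneg _
  have hZi : ∀ T, 0 < T → IntegrableOn Z (Ioc 0 T) := fun T hT =>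
    (hw.integrableOn_toReal_eGradNormSq hT).1
  have hWi : ∀ T, 0 < T → IntegrableOn W (Ioc 0 T) := fun T hT => hw.integrableOn_integral_norm_sq hT
  have hpin : ∀ t, 1 ≤ t → Z t ≤ Λ * W t + K * Real.exp cc * Real.exp (-cc * t) := fun t ht => by
    have := hK t ht
    simpa only [hZ, hW, hΛ, hcc, neg_mul] using this
  -- Cesàro energy of `v`, shifted to `w = v(· + s₀)`
  obtain ⟨T₁, hT₁, hcesv⟩ := exists_cesaro_energy_le hν hg hgm hv hE
  have hB : 0 ≤ E + 1 := by linarith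
  have hcesw := cesaro_translate (W := fun t => ∫ x, ‖v t x‖ ^ 2)
    (fun t => integral_nonneg fun _ => sq_nonneg _) (fun T hT => hv.integrableOn_integral_norm_sq hT)
    hB hs₀.le hT₁ hcesv
  -- Cesàro enstrophy of `w`
  obtain ⟨T₀, hT₀, hcesZ⟩ := exists_cesaro_of_pincer hZ0 hW0 hZi hWi hΛ0 (by positivity) hcc0
    hpin (fun T hT => by
      have := hcesw T hT
      simpa only [hW] using this)
  -- the arg-max phase
  have hA : 0 ≤ Λ * (2 * (E + 1)) + 1 := by positivity
  obtain ⟨s₁, hs₁, -, hbud⟩ := exists_phase_linear_budget hZ0 hZi hA hT₀ hcesZ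
  refine ⟨s₀ + s₁, by linarith, fun t ht => ?_⟩
  have e : (fun τ => eGradNormSq (v (s₀ + s₁ + τ))) = fun τ => eGradNormSq (v ((τ + s₁) + s₀)) := by
    funext τ; rw [show s₀ + s₁ + τ = τ + s₁ + s₀ by ring]
  have hT' : 0 < s₁ + t + 1 := by linarith
  have hLH := hw (s₁ + t + 1) hT'
  have hsub : Ioo s₁ (t + s₁) ⊆ Ioo 0 (s₁ + t + 1) := fun τ hτ => ⟨hs₁.trans_lt hτ.1, by linarith [hτ.2]⟩
  have hmeas : AEMeasurable (fun τ => eGradNormSq (v (τ + s₀))) (volume.restrict (Ioo s₁ (t + s₁))) :=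
    hLH.aemeasurable_eGradNormSq.mono_measure (Measure.restrict_mono hsub le_rfl)
  have hfin : ∫⁻ τ in Ioo s₁ (t + s₁), eGradNormSq (v (τ + s₀)) ≠ ⊤ :=
    ((lintegral_mono_set hsub).trans_lt hLH.lintegral_eGradNormSq_lt_top).ne
  have hlt : ∀ᵐ τ ∂(volume.restrict (Ioo s₁ (t + s₁))), eGradNormSq (v (τ + s₀)) < ⊤ :=
    ae_lt_top' hmeas hfin
  rw [e, setLIntegral_Ioo_comp_add_right (fun σ => eGradNormSq (v (σ + s₀))) 0 t s₁, zero_add,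
    ENNReal.le_ofReal_iff_toReal_le hfin (by positivity), ← integral_toReal hmeas hlt]
  have hwin : ∫ τ in Ioo s₁ (t + s₁), (eGradNormSq (v (τ + s₀))).toReal = ∫ τ in s₁..(s₁ + t), Z τ := by
    rw [intervalIntegral.integral_of_le (by linarith), setIntegral_congr_set (Ioo_ae_eq_Ioc (α := ℝ)),
      show t + s₁ = s₁ + t by ring]
  rw [hwin]
  calc ∫ τ in s₁..(s₁ + t), Z τ ≤ (2 * (Λ * (2 * (E + 1)) + 1) + 1) * t := hbud t ht
    _ = (16 * Real.pi ^ 2 * m * (E + 1) + 3) * t := by rw [hΛ]; ring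
    _ ≤ (16 * Real.pi ^ 2 * m * (E + 1) + 3) * (1 + t) := by
        have : 0 ≤ 16 * Real.pi ^ 2 * m * (E + 1) := by positivity
        nlinarith

end LerayHopf

/-! ## The excluded class: single-shell forcing -/

/-- **Single-shell forcing**: the force is supported on ONE Fourier shell `|k|² = m`, `m > 0`
(every Kolmogorov forcing `sin(2πℓx₂)e₁`, `m = ℓ²`; every monochromatic `g`). -/
def SingleShell (g : 𝕋² → E²) (_h : 𝕋² → ℝ) (_ν : ℕ → ℝ) (_v : ℕ → ℝ → 𝕋² → E²) : Prop :=
  ∃ m : ℝ, 0 < m ∧ ∀ k : Fin 2 → ℤ, freqNormSq k ≠ m → mFourierCoeff (EuclideanSpace.complexify ∘ g) k = 0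

/-- **`RelaxingFamily` is false without a multi-shell force** (unconditional; the route's kill
criterion "single-shell `g` is dead: ShellPincer + Seis" as a theorem): no witness of the crux is
driven by a single-shell force. Along such a family the mean enstrophy is `≤ 4π²mE` uniformly in the
level, a late arg-max phase has a `j`-uniform quadratic windowed enstrophy budget
(`exists_phase_quadraticBudget_of_singleShell`; the energy clause is automatic for mean-zero forces),
and the Seis floor (`relaxingFamily_false_without_superlinearMeanEnstrophy`) forbids `ν`-uniform
relaxation. Any proof of
`RelaxingFamily` must force at least two shells. [cite: Seis2022, Remark 1 (arXiv:2003.08794 p. 4); ConstantinTarfuleaVicol2013, §2 (enst)] -/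
theorem relaxingFamily_false_without_multiShell : ¬ RelaxingFamilyUnder SingleShell := by
  rintro ⟨g, h, hg, hgd, hgm, hh, hhm, hh0, ν, v₀, v, hν, hνlim, hLH, hbd, ⟨E, hE⟩, ⟨m, hm, hg1⟩, hrest⟩
  set E' : ℝ := max E 0 with hE'
  have hE'0 : 0 ≤ E' := le_max_right _ _
  have hE'' : ∀ j, meanEnergy (v j) ≤ E' := fun j => (hE j).trans (le_max_left _ _)
  refine relaxingFamily_false_without_superlinearMeanEnstrophy
    ⟨g, h, hg, hgd, hgm, hh, hhm, hh0, ν, v₀, v, hν, hνlim, hLH, hbd, ⟨E, hE⟩,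
      ⟨16 * Real.pi ^ 2 * m * (E' + 1) + 3, by positivity, fun j => ?_⟩, hrest⟩
  obtain ⟨s, hs, hbud⟩ :=
    exists_phase_quadraticBudget_of_singleShell (hν j) hg hgm hm hg1 (hLH j) hE'0 (hE'' j)
  -- the energy clause is automatic (FMRT 2001 (3.2): mean-zero steady force)
  obtain ⟨R, hR⟩ := (hLH j).exists_forall_integral_norm_sq_le_of_hasZeroMean (hν j) (hg.memLp 2) hgm
  refine ⟨s, hs, ⟨R.toNNReal, (ae_restrict_mem measurableSet_Ioi).mono fun t ht => ?_⟩, hbud⟩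
  have hst : 0 ≤ s + t := by have := mem_Ioi.1 ht; linarith
  rw [Literature.Analysis.FluidPDE.lintegral_enorm_sq_eq_ofReal ((hLH j).memLp_two hst)]
  exact ENNReal.ofReal_le_ofReal (hR _ hst)

end Summit.AnomalousDissipation.AnomalousDissipation.Theorems.RelaxingFamily.Negative

end
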